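import Summits.ValiantsHypothesis.ValiantsHypothesis.Theses.BarrierLever
import Summits.ValiantsHypothesis.ValiantsHypothesis.Theorems.BarrierLeverPriorityPeelingDecidesTransversal
import Summits.ValiantsHypothesis.ValiantsHypothesis.Theorems.BarrierLeverHubToolkit
import Summits.ValiantsHypothesis.ValiantsHypothesis.Theorems.BarrierLeverCompressionMove

/-!
# Route BarrierLever — item 19931 `HubCertificatesDecideTransversal` (glue for the HUB CALCULUS of TT):
# the hub calculus is SOUND

Helper file (`--supports stmt-ValiantsHypothesis-19931`; cell valiant-natproofs, rung V4, 𝒟-side of door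
(c); planner p1-g13's `HOME/p1/hub-g13/GlueCheck.lean`, ported by seat val-np-p4 gen 9). Item 19931 is
`HubCertificatesExist → TransversalMinorLayoutsNonsingular`: the matrix-free HUB CALCULUS of item 19930
(closure under (0) reindexing, (1) transposition, (2) independent literal relabelings, (3) the
rearrangement base, (4) column compression `x ← y` WITH BLOCKING, (5) the HUB rule; HUB-MEMO-g8 I3/I4)
is SOUND for conjecture TT (item 19152).

At the time of writing the route file has not yet been re-rendered with the decls of items
19930–19933, so `hubCalculus_sound` states the item with the hypothesis `HubCertificatesExist` SPELLED
OUT (the filed signature verbatim) and the conclusion `Theses.BarrierLever.TransversalMinorLayoutsNonsingular`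
by name; the by-name wrapper `theorem … : Theses.BarrierLever.HubCertificatesDecideTransversal` is a
one-line follow-up once the decl exists (both sides unfold to the same term).

**Proof** (planner p1-g13): instantiate `P := ALIVE` («some `G` makes the layout matrix `det G[ρ i, κ j]`
nonsingular») and discharge the six closure rules with tree theorems — (0) `PPGlue.alive_of_reindex`,
(1) `PPGlue.alive_of_transpose`, (2) `Matrix.submatrix` along the inverse permutations, (3)
`Hub.alive_of_rearrangement` (p478917), (4) `Compression.compressionMove` (p478445; the bookkeeping data
`qx / partner / sgn / aff / blk` are chosen from the rule's hypotheses), (5) `Hub.alive_trans_of_hub`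
(p477861).

WHAT THIS IS NOT: soundness only — nothing on the EXISTENCE of hub certificates (item 19930, the
residual; its `h = 4` slice holds by explicit words, planner kit j264956), on TT / TNS / item 19717 in
general, on crux stmt-ValiantsHypothesis-14610, or on `VP` versus `VNP`.
-/

-- layout Summits/ValiantsHypothesis/ValiantsHypothesis forces the duplicated namespace component
set_option linter.dupNamespace false

namespace Summit.ValiantsHypothesis.ValiantsHypothesis.Theorems.BarrierLever.HubGlue

open Summit.ValiantsHypothesis.ValiantsHypothesis.Theorems.BarrierLever

/-- **The hub calculus is sound** — item 19931 `HubCertificatesDecideTransversal` with its hypothesis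
`HubCertificatesExist` (item 19930) spelled out verbatim: every predicate on configurations closed under
rules (0)–(5) holds at every injective TT layout ⟹ TT (item 19152, by name). -/
theorem hubCalculus_sound :
    ((∀ P : (nr nc r d : ℕ) → (Fin r → Fin d → Fin nr) → (Fin r → Fin d → Fin nc) → Prop,
    (∀ (nr nc r d : ℕ) (ρ : Fin r → Fin d → Fin nr) (κ : Fin r → Fin d → Fin nc)
        (σ τ : Equiv.Perm (Fin r)) (α β : Fin r → Equiv.Perm (Fin d)),
        P nr nc r d (fun i a => ρ (σ i) (α i a)) (fun j c => κ (τ j) (β j c)) → P nr nc r d ρ κ) →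
    (∀ (nr nc r d : ℕ) (ρ : Fin r → Fin d → Fin nr) (κ : Fin r → Fin d → Fin nc),
        P nc nr r d κ ρ → P nr nc r d ρ κ) →
    (∀ (nr nc r d : ℕ) (ρ : Fin r → Fin d → Fin nr) (κ : Fin r → Fin d → Fin nc)
        (π : Equiv.Perm (Fin nr)) (σ : Equiv.Perm (Fin nc)),
        P nr nc r d ρ κ → P nr nc r d (fun i a => π (ρ i a)) (fun j c => σ (κ j c))) →
    (∀ (n r d : ℕ) (H K : Fin r → Fin d → Fin n) (π : Equiv.Perm (Fin r))
        (τ : Fin r → Equiv.Perm (Fin d)),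
        (∀ j, StrictMono (H j)) → Function.Injective H → (∀ j, K j = H (π j) ∘ (τ j)) →
        P n n r d H K) →
    (∀ (nr nc r d : ℕ) (ρ : Fin r → Fin d → Fin nr) (κ κ' : Fin r → Fin d → Fin nc) (x y : Fin nc),
        x ≠ y → (∀ j, Function.Injective (κ j)) →
        (∀ j, κ' j = κ j ∨ ((∃ q, κ j q = x) ∧ (∀ q, κ j q ≠ y) ∧
          κ' j = fun q => if κ j q = x then y else κ j q)) →
        (∀ j, κ' j = κ j → (∃ q, κ j q = x) → (∀ q, κ j q ≠ y) →
          ∃ (j' : Fin r) (τ : Equiv.Perm (Fin d)),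
            (fun q => if κ j q = x then y else κ j q) = κ j' ∘ (τ : Fin d → Fin d)) →
        P nr nc r d ρ κ' → P nr nc r d ρ κ) →
    (∀ (n r d : ℕ) (S T H : Fin r → Fin d → Fin n) (ψ : Fin n → ℕ),
        (∀ j, StrictMono (H j)) → Function.Injective H →
        (∀ H' : Fin r → Fin d → Fin n, (∀ j, StrictMono (H' j)) → Function.Injective H' →
          (∑ j, ∑ a, ψ (H' j a)) = (∑ j, ∑ a, ψ (H j a)) →
          ∃ σ : Equiv.Perm (Fin r), ∀ j, H' j = H (σ j)) →
        P n n r d S H → P n n r d T H → P n n r d S T) →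
    ∀ (h r : ℕ) (u w : Fin r → Finset (Fin h)), Function.Injective u → Function.Injective w →
      P (h + h) (h + h) r h (fun i a => if a ∈ u i then Fin.castAdd h a else Fin.natAdd h a)
        (fun j c => if c ∈ w j then Fin.natAdd h c else Fin.castAdd h c))) →
    Theses.BarrierLever.TransversalMinorLayoutsNonsingular := by
  intro hcert h r u w hu hw
  refine hcert (fun nr nc r d ρ κ => ∃ G : Matrix (Fin nr) (Fin nc) ℂ,
      (Matrix.of fun i j : Fin r => (G.submatrix (ρ i) (κ j)).det).det ≠ 0)
    ?_ ?_ ?_ ?_ ?_ ?_ h r u w hu hw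
  · -- (0) reindexing
    intro nr nc r d ρ κ σ τ α β hP
    exact PPGlue.alive_of_reindex ρ κ σ τ α β hP
  · -- (1) transposition
    intro nr nc r d ρ κ hP
    exact PPGlue.alive_of_transpose ρ κ hP
  · -- (2) literal relabeling
    rintro nr nc r d ρ κ π σ ⟨G, hG⟩
    refine ⟨G.submatrix π.symm σ.symm, ?_⟩
    have hM : (Matrix.of fun i j : Fin r => ((G.submatrix π.symm σ.symm).submatrix
        (fun a => π (ρ i a)) (fun c => σ (κ j c))).det) =
        Matrix.of fun i j : Fin r => (G.submatrix (ρ i) (κ j)).det := by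
      ext i j
      simp [Matrix.submatrix_submatrix, Function.comp_def]
    rw [hM]
    exact hG
  · -- (3) rearrangement base
    intro n r d H K π τ hHm hHi hK
    exact Hub.alive_of_rearrangement H K hHm hHi π τ hK
  · -- (4) compression with blocking
    intro nr nc r d ρ κ κ' x y hxy hinj hmove hblock hP'
    classical
    rcases Nat.eq_zero_or_pos d with hd | hd
    · subst hd
      have hk : κ' = κ := by
        funext j q
        exact q.elim0
      rw [← hk]
      exact hP'
    · -- choice of the bookkeeping data of `compressionMove`
      obtain ⟨qx, hqx⟩ : ∃ qx : Fin r → Fin d, ∀ j, (∃ q, κ j q = x) → κ j (qx j) = x := by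
        refine ⟨fun j => if hq : ∃ q, κ j q = x then hq.choose else ⟨0, hd⟩, fun j hq => ?_⟩
        simp only [dif_pos hq]
        exact hq.choose_spec
      have hupd : ∀ j, (∃ q, κ j q = x) →
          Function.update (κ j) (qx j) y = fun q => if κ j q = x then y else κ j q := by
        intro j hq
        funext q
        by_cases hq' : q = qx j
        · subst hq'
          rw [Function.update_self, if_pos (hqx j hq)]
        · rw [Function.update_of_ne hq', if_neg]
          intro hx
          exact hq' (hinj j (hx.trans (hqx j hq).symm))
      obtain ⟨partner, sgn, hps⟩ : ∃ (partner : Fin r → Fin r) (sgn : Fin r → Equiv.Perm (Fin d)),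
          ∀ j, κ' j = κ j → (∃ q, κ j q = x) → (∀ q, κ j q ≠ y) →
            (fun q => if κ j q = x then y else κ j q) = κ (partner j) ∘ (sgn j) := by
        refine ⟨fun j => if hj : κ' j = κ j ∧ (∃ q, κ j q = x) ∧ (∀ q, κ j q ≠ y) then
            (hblock j hj.1 hj.2.1 hj.2.2).choose else j,
          fun j => if hj : κ' j = κ j ∧ (∃ q, κ j q = x) ∧ (∀ q, κ j q ≠ y) then
            (hblock j hj.1 hj.2.1 hj.2.2).choose_spec.choose else Equiv.refl _, ?_⟩
        intro j h1 h2 h3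
        have hj : κ' j = κ j ∧ (∃ q, κ j q = x) ∧ (∀ q, κ j q ≠ y) := ⟨h1, h2, h3⟩
        simp only [dif_pos hj]
        exact (hblock j hj.1 hj.2.1 hj.2.2).choose_spec.choose_spec
      obtain ⟨aff, haff⟩ : ∃ aff : Fin r → Bool, ∀ j, aff j = true ↔ κ' j ≠ κ j :=
        ⟨fun j => decide (κ' j ≠ κ j), fun j => by simp⟩
      obtain ⟨blk, hblk⟩ : ∃ blk : Fin r → Bool, ∀ j, blk j = true ↔
          (κ' j = κ j ∧ (∃ q, κ j q = x) ∧ (∀ q, κ j q ≠ y)) :=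
        ⟨fun j => decide (κ' j = κ j ∧ (∃ q, κ j q = x) ∧ (∀ q, κ j q ≠ y)), fun j => by simp⟩
      refine Compression.compressionMove (ι := Fin r) ρ κ hinj x y hxy aff blk qx partner sgn
        ?_ ?_ ?_ ?_ ?_
      · -- moved columns are eligible
        intro j hj
        have hne : κ' j ≠ κ j := (haff j).mp hj
        rcases hmove j with h | ⟨hq, hy, -⟩
        · exact absurd h hne
        · exact ⟨hqx j hq, hy⟩
      · -- blocked columns
        intro j hj
        obtain ⟨h1, h2, h3⟩ := (hblk j).mp hj
        exact ⟨hqx j h2, h3, (hupd j h2).trans (hps j h1 h2 h3)⟩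
      · -- moved and blocked are disjoint
        rintro j ⟨h1, h2⟩
        exact ((haff j).mp h1) ((hblk j).mp h2).1
      · -- kept unblocked columns are ineligible
        intro j h1 h2
        have h1' : ¬ (aff j = true) := by rw [h1]; exact Bool.false_ne_true
        have h2' : ¬ (blk j = true) := by rw [h2]; exact Bool.false_ne_true
        have heq : κ' j = κ j := by
          by_contra hne
          exact h1' ((haff j).mpr hne)
        by_cases hx : ∃ q, κ j q = x
        · right
          by_contra hy
          push Not at hy
          exact h2' ((hblk j).mpr ⟨heq, hx, hy⟩)
        · left
          push Not at hx
          exact hx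
      · -- the compressed configuration is `(ρ, κ')`, alive by hypothesis
        obtain ⟨G', hG'⟩ := hP'
        refine ⟨G', ?_⟩
        have hcol : ∀ j, (if aff j then Function.update (κ j) (qx j) y else κ j) = κ' j := by
          intro j
          by_cases hne : κ' j ≠ κ j
          · rw [if_pos ((haff j).mpr hne)]
            rcases hmove j with h | ⟨hq, -, hk'⟩
            · exact absurd h hne
            · rw [hk', hupd j hq]
          · have hF : ¬ (aff j = true) := fun h => hne ((haff j).mp h)
            rw [if_neg hF]
            push Not at hne
            exact hne.symm
        have hM : (Matrix.of fun i j : Fin r => (G'.submatrix (ρ i)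
            (if aff j then Function.update (κ j) (qx j) y else κ j)).det) =
            Matrix.of fun i j : Fin r => (G'.submatrix (ρ i) (κ' j)).det := by
          ext i j
          rw [Matrix.of_apply, Matrix.of_apply, hcol j]
        rw [hM]
        exact hG'
  · -- (5) hub rule
    intro n r d S T H ψ hHm hHi hH hS hT
    exact Hub.alive_trans_of_hub S T H ψ hHm hHi hH hS hT

/-- **Item 19931 `HubCertificatesDecideTransversal` BY NAME** (the route file now renders the decls
`HubCertificatesExist` / `HubCertificatesDecideTransversal`, rev ≥ 10): the hub calculus is sound —
`HubCertificatesExist → TransversalMinorLayoutsNonsingular` — by `hubCalculus_sound`, whose hypothesis is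
`HubCertificatesExist` unfolded verbatim. -/
theorem hubCertificatesDecideTransversal : Theses.BarrierLever.HubCertificatesDecideTransversal :=
  fun h => hubCalculus_sound h

end Summit.ValiantsHypothesis.ValiantsHypothesis.Theorems.BarrierLever.HubGlue
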